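import Summits.Ventures.Crystal3D.Theorems.StickyWulffConstantGenericWallFloorRayAlignedWord
import Summits.Ventures.Crystal3D.Theorems.StickyWulffConstantCoaxialWallLawMenuFrames
import Summits.Ventures.Crystal3D.Theorems.StickyWulffConstantGenericWallFloorCoaxialCriterion
import HarnessLib

/-!
# Two sufficient criteria for `RayAlignedAt`: the level-0 twin of one grain adjacent to the other grain

HONEST FRAMING. Part of the venture `Summits/Ventures/Crystal3D` (cell `crystal3d-full`), helper `--supports` the
crux `GenericWallFloor` (stmt-Ventures-19480) of `route-Ventures-StickyWulffConstant`, registered line `WallLedgerG`,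
open stub `stub_twoSlabAdhesion`.  Third file of the WORD HALF of G-CL (cf-p1 DECISION (l)); answers the planner's
viability condition V1 («which Σ9-related pairs are in the ray-aligned Core?») on the positive side.

`RayAlignedAt A₁ A₂` asks, for EVERY steep pair of launch slots, for a co-axial coincidence between a chain frame of
grain 1 (upward) and one of grain 2 (downward).  Two mechanisms produce such coincidences at level `0` uniformly:

* `coaxial_of_image_eq_or_twin` — the converse of `eq_or_twin_of_coaxial`: equal lattices, or mirror twins across a
  menu normal, are co-axial (`exists_frame_of_menu`, `twin_image_eq_frame_negConst`, `coaxial_of_common_frame`).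
* `twinFrame_neg`, `level_zero_mem_chainFrames` — the level-0 frame of the forced ray of `u` along `±m` (`m` a unit menu
  normal ADJACENT to the launch slot, `⟪A u, m⟫ ≠ 0`) is a chain frame with lattice `(twinFrame A m)·Λ₀`.
* **`rayAlignedAt_of_adjacent_up`** (M1) — if a unit menu normal `m₁` of `A₁` is adjacent to EVERY steep-up slot of
  grain 1 and the twin lattice `(twinFrame A₁ m₁)·Λ₀` equals `A₂·Λ₀` or a mirror twin of it, then `RayAlignedAt A₁ A₂`.
* **`rayAlignedAt_of_adjacent_down`** (M2) — symmetrically with a unit menu normal `m₂` of `A₂` adjacent to every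
  steep-down slot of grain 2 and `(twinFrame A₂ m₂)·Λ₀` equal to `A₁·Λ₀` or a mirror twin of it.
* **`rayAlignedAt_of_word_two_up` / `_down`** — the `Σ9` form: `A₂·Λ₀ = (wordFrame A₁ [κ₀, κ₁])·Λ₀` with unit model
  menu letters; (M1) every steep-up slot `u₁` has `⟪u₁, κ₁⟫ ≠ 0`, or (M2) every steep-down slot `u₂` of grain 2 has
  `⟪A₂ u₂, (wordFrame A₁ [κ₁]) κ₀⟫ ≠ 0` (adjacent to the back plane) ⇒ `RayAlignedAt A₁ A₂`.

Consequence recorded for the planner (numerics in the cell INBOX, 2026-08-28): the ASYMMETRIC tilt `Σ9`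
(`κ₁ = (1,1,−1)/√3` first, `κ₀ = (1,1,1)/√3`), whose grain 2 sees the wall within `33°` of its own `(111)`, satisfies (M2)
on the whole half-chord cap — it is in the Core although it is no terrace word of the steep families.

WHAT THIS IS NOT: not the stub; no counting; F-C1 not moved; the converse (ray-aligned two-letter pairs satisfy M1 or M2
per steep pair) is the next file.
-/

noncomputable section

namespace Summit.Ventures.Crystal3D.Theorems

open Summit.Ventures.Crystal3D Finset
open Literature.MathematicalPhysics.StatisticalMechanics (fccStacking barlowStacking IsHaggSeq)
open scoped InnerProductSpace

/-! ### Equal or twin lattices are co-axial -/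

/-- **Equal lattices, or mirror twins across a menu normal, are co-axial** (converse of `eq_or_twin_of_coaxial`). -/
theorem coaxial_of_image_eq_or_twin (F₁ F₂ : EuclideanSpace ℝ (Fin 3) ≃ₗᵢ[ℝ] EuclideanSpace ℝ (Fin 3))
    (h : F₁ '' fccStacking 1 (Real.sqrt (2 / 3)) = F₂ '' fccStacking 1 (Real.sqrt (2 / 3)) ∨
      ∃ m : EuclideanSpace ℝ (Fin 3), ‖m‖ = 1 ∧
        (∀ w ∈ fccSlots, ⟪F₁ w, m⟫_ℝ = 0 ∨ ⟪F₁ w, m⟫_ℝ = Real.sqrt (2 / 3) ∨ ⟪F₁ w, m⟫_ℝ = -Real.sqrt (2 / 3)) ∧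
        F₂ '' fccStacking 1 (Real.sqrt (2 / 3)) = twinFrame F₁ m '' fccStacking 1 (Real.sqrt (2 / 3))) :
    ∃ (L : EuclideanSpace ℝ (Fin 3) ≃ₗᵢ[ℝ] EuclideanSpace ℝ (Fin 3))
      (s₁ s₂ : EuclideanSpace ℝ (Fin 3)) (σ σ' : ℤ → ℤ), IsHaggSeq σ ∧ IsHaggSeq σ' ∧
      F₁ '' fccStacking 1 (Real.sqrt (2 / 3)) ⊆ (fun p => L p + s₁) '' barlowStacking 1 (Real.sqrt (2 / 3)) σ ∧
      F₂ '' fccStacking 1 (Real.sqrt (2 / 3)) ⊆ (fun p => L p + s₂) '' barlowStacking 1 (Real.sqrt (2 / 3)) σ' := by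
  have key : ∀ L : EuclideanSpace ℝ (Fin 3) ≃ₗᵢ[ℝ] EuclideanSpace ℝ (Fin 3),
      (F₁ '' fccStacking 1 (Real.sqrt (2 / 3)) = L '' fccStacking 1 (Real.sqrt (2 / 3)) ∨
        F₁ '' fccStacking 1 (Real.sqrt (2 / 3)) = L '' barlowStacking 1 (Real.sqrt (2 / 3)) (fun _ : ℤ => (-1 : ℤ))) →
      (F₂ '' fccStacking 1 (Real.sqrt (2 / 3)) = L '' fccStacking 1 (Real.sqrt (2 / 3)) ∨
        F₂ '' fccStacking 1 (Real.sqrt (2 / 3)) = L '' barlowStacking 1 (Real.sqrt (2 / 3)) (fun _ : ℤ => (-1 : ℤ))) →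
      ∃ (L : EuclideanSpace ℝ (Fin 3) ≃ₗᵢ[ℝ] EuclideanSpace ℝ (Fin 3))
        (s₁ s₂ : EuclideanSpace ℝ (Fin 3)) (σ σ' : ℤ → ℤ), IsHaggSeq σ ∧ IsHaggSeq σ' ∧
        F₁ '' fccStacking 1 (Real.sqrt (2 / 3)) ⊆ (fun p => L p + s₁) '' barlowStacking 1 (Real.sqrt (2 / 3)) σ ∧
        F₂ '' fccStacking 1 (Real.sqrt (2 / 3)) ⊆ (fun p => L p + s₂) '' barlowStacking 1 (Real.sqrt (2 / 3)) σ' := by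
    intro L h₁ h₂
    obtain ⟨L', s₁, s₂, σ, σ', hσ, hσ', e₁, e₂⟩ := coaxial_of_common_frame F₁ F₂ L 0 0 h₁ h₂
    refine ⟨L', s₁, s₂, σ, σ', hσ, hσ', ?_, ?_⟩
    · simpa only [add_zero] using e₁
    · simpa only [add_zero] using e₂
  rcases h with hEq | ⟨m, hm, hmenu, hEq⟩
  · exact key F₁ (Or.inl rfl) (Or.inl hEq.symm)
  · obtain ⟨L, hL, hLe⟩ := exists_frame_of_menu F₁ hm hmenu
    exact key L (Or.inl hL.symm) (Or.inr (twin_image_eq_frame_negConst hm hL hLe hEq))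

/-! ### Level 0 of a ray -/

/-- The twin frame does not see the sign of its normal. -/
theorem twinFrame_neg (A : EuclideanSpace ℝ (Fin 3) ≃ₗᵢ[ℝ] EuclideanSpace ℝ (Fin 3)) {m : EuclideanSpace ℝ (Fin 3)}
    (hm : ‖m‖ = 1) : twinFrame A (-m) = twinFrame A m := by
  unfold twinFrame
  rw [reflection_neg_eq hm]

/-- **The level-0 frame along an adjacent menu normal is a chain frame.**  For a slot `u` and a unit menu normal `m` of
`A` with `⟪A u, m⟫ ≠ 0`, some chain frame of `(A, u)` has the lattice `(twinFrame A m)·Λ₀`. -/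
theorem level_zero_mem_chainFrames (z : EuclideanSpace ℝ (Fin 3))
    (A : EuclideanSpace ℝ (Fin 3) ≃ₗᵢ[ℝ] EuclideanSpace ℝ (Fin 3)) {u m : EuclideanSpace ℝ (Fin 3)} (hu : u ∈ fccSlots)
    (hm : ‖m‖ = 1)
    (hmenu : ∀ w ∈ fccSlots, ⟪A w, m⟫_ℝ = 0 ∨ ⟪A w, m⟫_ℝ = Real.sqrt (2 / 3) ∨ ⟪A w, m⟫_ℝ = -Real.sqrt (2 / 3))
    (hadj : ⟪A u, m⟫_ℝ ≠ 0) :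
    ∃ F ∈ chainFrames z A u,
      F '' fccStacking 1 (Real.sqrt (2 / 3)) = twinFrame A m '' fccStacking 1 (Real.sqrt (2 / 3)) := by
  rcases hmenu u hu with h | h | h
  · exact absurd h hadj
  · exact ⟨(forcedTop z ⟨A, u, 0⟩ m 0).frame, Or.inr ⟨m, hm, hmenu, h, 0, rfl⟩, rfl⟩
  · have hm' : ‖-m‖ = 1 := by rw [norm_neg, hm]
    have hmenu' : ∀ w ∈ fccSlots, ⟪A w, -m⟫_ℝ = 0 ∨ ⟪A w, -m⟫_ℝ = Real.sqrt (2 / 3) ∨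
        ⟪A w, -m⟫_ℝ = -Real.sqrt (2 / 3) := by
      intro w hw
      rw [inner_neg_right]
      rcases hmenu w hw with h' | h' | h'
      · left; rw [h', neg_zero]
      · right; right; rw [h']
      · right; left; rw [h', neg_neg]
    refine ⟨(forcedTop z ⟨A, u, 0⟩ (-m) 0).frame, Or.inr ⟨-m, hm', hmenu', by rw [inner_neg_right, h, neg_neg], 0, rfl⟩,
      ?_⟩
    show twinFrame A (-m) '' _ = _
    rw [twinFrame_neg A hm]

/-! ### The two criteria -/

/-- **(M1) The level-0 twin of grain 1 adjacent to grain 2.**  If a unit menu normal `m₁` of `A₁` is adjacent to every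
steep-up slot of grain 1, and `(twinFrame A₁ m₁)·Λ₀` is `A₂·Λ₀` or a mirror twin of `A₂·Λ₀` across a menu normal of
`A₂`, then the pair is ray-aligned. -/
theorem rayAlignedAt_of_adjacent_up {A₁ A₂ : EuclideanSpace ℝ (Fin 3) ≃ₗᵢ[ℝ] EuclideanSpace ℝ (Fin 3)}
    {m₁ : EuclideanSpace ℝ (Fin 3)} (hm₁ : ‖m₁‖ = 1)
    (hmenu₁ : ∀ w ∈ fccSlots, ⟪A₁ w, m₁⟫_ℝ = 0 ∨ ⟪A₁ w, m₁⟫_ℝ = Real.sqrt (2 / 3) ∨ ⟪A₁ w, m₁⟫_ℝ = -Real.sqrt (2 / 3))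
    (hadj : ∀ u₁ ∈ fccSlots, Real.sqrt 2 / 2 ≤ ⟪A₁ u₁, EuclideanSpace.single (2 : Fin 3) (1 : ℝ)⟫_ℝ → ⟪A₁ u₁, m₁⟫_ℝ ≠ 0)
    (hlat : twinFrame A₁ m₁ '' fccStacking 1 (Real.sqrt (2 / 3)) = A₂ '' fccStacking 1 (Real.sqrt (2 / 3)) ∨
      ∃ m₂ : EuclideanSpace ℝ (Fin 3), ‖m₂‖ = 1 ∧
        (∀ w ∈ fccSlots, ⟪A₂ w, m₂⟫_ℝ = 0 ∨ ⟪A₂ w, m₂⟫_ℝ = Real.sqrt (2 / 3) ∨ ⟪A₂ w, m₂⟫_ℝ = -Real.sqrt (2 / 3)) ∧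
        twinFrame A₁ m₁ '' fccStacking 1 (Real.sqrt (2 / 3)) = twinFrame A₂ m₂ '' fccStacking 1 (Real.sqrt (2 / 3))) :
    RayAlignedAt A₁ A₂ := by
  intro u₁ hu₁ hs₁ u₂ _ _
  obtain ⟨F₁, hF₁, hF₁img⟩ :=
    level_zero_mem_chainFrames (EuclideanSpace.single (2 : Fin 3) (1 : ℝ)) A₁ hu₁ hm₁ hmenu₁ (hadj u₁ hu₁ hs₁)
  refine ⟨F₁, hF₁, A₂, self_mem_chainFrames _ A₂ u₂, ?_⟩
  rcases hlat with hEq | ⟨m₂, hm₂, hmenu₂, hEq⟩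
  · exact coaxial_of_image_eq_or_twin F₁ A₂ (Or.inl (by rw [hF₁img, hEq]))
  · exact coaxial_linear_symm (coaxial_of_image_eq_or_twin A₂ F₁ (Or.inr ⟨m₂, hm₂, hmenu₂, by rw [hF₁img, hEq]⟩))

/-- **(M2) The level-0 twin of grain 2 adjacent to grain 1.**  If a unit menu normal `m₂` of `A₂` is adjacent to every
steep-down slot of grain 2, and `(twinFrame A₂ m₂)·Λ₀` is `A₁·Λ₀` or a mirror twin of `A₁·Λ₀` across a menu normal of
`A₁`, then the pair is ray-aligned. -/
theorem rayAlignedAt_of_adjacent_down {A₁ A₂ : EuclideanSpace ℝ (Fin 3) ≃ₗᵢ[ℝ] EuclideanSpace ℝ (Fin 3)}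
    {m₂ : EuclideanSpace ℝ (Fin 3)} (hm₂ : ‖m₂‖ = 1)
    (hmenu₂ : ∀ w ∈ fccSlots, ⟪A₂ w, m₂⟫_ℝ = 0 ∨ ⟪A₂ w, m₂⟫_ℝ = Real.sqrt (2 / 3) ∨ ⟪A₂ w, m₂⟫_ℝ = -Real.sqrt (2 / 3))
    (hadj : ∀ u₂ ∈ fccSlots, ⟪A₂ u₂, EuclideanSpace.single (2 : Fin 3) (1 : ℝ)⟫_ℝ ≤ -(Real.sqrt 2 / 2) →
      ⟪A₂ u₂, m₂⟫_ℝ ≠ 0)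
    (hlat : twinFrame A₂ m₂ '' fccStacking 1 (Real.sqrt (2 / 3)) = A₁ '' fccStacking 1 (Real.sqrt (2 / 3)) ∨
      ∃ m₁ : EuclideanSpace ℝ (Fin 3), ‖m₁‖ = 1 ∧
        (∀ w ∈ fccSlots, ⟪A₁ w, m₁⟫_ℝ = 0 ∨ ⟪A₁ w, m₁⟫_ℝ = Real.sqrt (2 / 3) ∨ ⟪A₁ w, m₁⟫_ℝ = -Real.sqrt (2 / 3)) ∧
        twinFrame A₂ m₂ '' fccStacking 1 (Real.sqrt (2 / 3)) = twinFrame A₁ m₁ '' fccStacking 1 (Real.sqrt (2 / 3))) :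
    RayAlignedAt A₁ A₂ := by
  intro u₁ _ _ u₂ hu₂ hs₂
  obtain ⟨F₂, hF₂, hF₂img⟩ :=
    level_zero_mem_chainFrames (-EuclideanSpace.single (2 : Fin 3) (1 : ℝ)) A₂ hu₂ hm₂ hmenu₂ (hadj u₂ hu₂ hs₂)
  refine ⟨A₁, self_mem_chainFrames _ A₁ u₁, F₂, hF₂, ?_⟩
  rcases hlat with hEq | ⟨m₁, hm₁, hmenu₁, hEq⟩
  · exact coaxial_of_image_eq_or_twin A₁ F₂ (Or.inl (by rw [hF₂img, hEq]))
  · exact coaxial_of_image_eq_or_twin A₁ F₂ (Or.inr ⟨m₁, hm₁, hmenu₁, by rw [hF₂img, hEq]⟩)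

/-! ### The `Σ9` form: two-letter words -/

/-- A unit model menu letter, pushed to real space by a frame, is a unit menu normal of that frame. -/
theorem menu_frame_of_model (G : EuclideanSpace ℝ (Fin 3) ≃ₗᵢ[ℝ] EuclideanSpace ℝ (Fin 3))
    {μ : EuclideanSpace ℝ (Fin 3)}
    (hμ : ∀ w ∈ fccSlots, ⟪w, μ⟫_ℝ = 0 ∨ ⟪w, μ⟫_ℝ = Real.sqrt (2 / 3) ∨ ⟪w, μ⟫_ℝ = -Real.sqrt (2 / 3)) :
    ∀ w ∈ fccSlots, ⟪G w, G μ⟫_ℝ = 0 ∨ ⟪G w, G μ⟫_ℝ = Real.sqrt (2 / 3) ∨ ⟪G w, G μ⟫_ℝ = -Real.sqrt (2 / 3) := by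
  intro w hw
  rw [LinearIsometryEquiv.inner_map_map]
  exact hμ w hw

/-- The one-letter word as the twin across the pushed letter: `wordFrame G [μ] = twinFrame G (G μ)`. -/
theorem wordFrame_singleton_eq_twinFrame (G : EuclideanSpace ℝ (Fin 3) ≃ₗᵢ[ℝ] EuclideanSpace ℝ (Fin 3))
    {μ : EuclideanSpace ℝ (Fin 3)} (hμ : ‖μ‖ = 1) : wordFrame G [μ] = twinFrame G (G μ) := by
  rw [twinFrame_eq_wordFrame_singleton G (by rw [LinearIsometryEquiv.norm_map, hμ]), LinearIsometryEquiv.symm_apply_apply]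

/-- The second twin, undone: `(wordFrame A₁ [κ₁])·Λ₀ = (twinFrame A₂ m)·Λ₀` for `m = (wordFrame A₁ [κ₁]) κ₀` when
`A₂·Λ₀ = (wordFrame A₁ [κ₀, κ₁])·Λ₀`; and `m` is a unit menu normal of `A₂`. -/
theorem backPlane_twin {A₁ A₂ : EuclideanSpace ℝ (Fin 3) ≃ₗᵢ[ℝ] EuclideanSpace ℝ (Fin 3)} {κ₀ κ₁ : EuclideanSpace ℝ (Fin 3)}
    (hκ₀ : ‖κ₀‖ = 1 ∧ ∀ w ∈ fccSlots, ⟪w, κ₀⟫_ℝ = 0 ∨ ⟪w, κ₀⟫_ℝ = Real.sqrt (2 / 3) ∨ ⟪w, κ₀⟫_ℝ = -Real.sqrt (2 / 3))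
    (hA₂ : A₂ '' fccStacking 1 (Real.sqrt (2 / 3)) = (wordFrame A₁ [κ₀, κ₁]) '' fccStacking 1 (Real.sqrt (2 / 3))) :
    ‖wordFrame A₁ [κ₁] κ₀‖ = 1 ∧
    (∀ w ∈ fccSlots, ⟪A₂ w, wordFrame A₁ [κ₁] κ₀⟫_ℝ = 0 ∨ ⟪A₂ w, wordFrame A₁ [κ₁] κ₀⟫_ℝ = Real.sqrt (2 / 3) ∨
      ⟪A₂ w, wordFrame A₁ [κ₁] κ₀⟫_ℝ = -Real.sqrt (2 / 3)) ∧
    wordFrame A₁ [κ₁] '' fccStacking 1 (Real.sqrt (2 / 3)) =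
      twinFrame A₂ (wordFrame A₁ [κ₁] κ₀) '' fccStacking 1 (Real.sqrt (2 / 3)) := by
  set W := wordFrame A₁ [κ₁] with hW
  have hm : ‖W κ₀‖ = 1 := by rw [LinearIsometryEquiv.norm_map, hκ₀.1]
  have hmenuW : ∀ w ∈ fccSlots, ⟪W w, W κ₀⟫_ℝ = 0 ∨ ⟪W w, W κ₀⟫_ℝ = Real.sqrt (2 / 3) ∨ ⟪W w, W κ₀⟫_ℝ = -Real.sqrt (2 / 3) :=
    menu_frame_of_model W hκ₀.2
  -- `A₂·Λ₀ = (twinFrame W (W κ₀))·Λ₀`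
  have hA₂' : A₂ '' fccStacking 1 (Real.sqrt (2 / 3)) = twinFrame W (W κ₀) '' fccStacking 1 (Real.sqrt (2 / 3)) := by
    rw [hA₂, show wordFrame A₁ [κ₀, κ₁] = wordFrame W [κ₀] by rw [hW, ← wordFrame_append]; rfl,
      wordFrame_singleton_eq_twinFrame W hκ₀.1]
  -- menu for the twin frame, hence for `A₂`
  have hmenuT := menu_reflect W (twinFrame W (W κ₀)) hm hmenuW (twinFrame_apply W hm)
  have hmenu₂ := menu_of_image_eq (twinFrame W (W κ₀)) A₂ hA₂'.symm hmenuT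
  refine ⟨hm, hmenu₂, ?_⟩
  -- undo the twin: reflect `A₂·Λ₀` back
  have hinv : ∀ S : Set (EuclideanSpace ℝ (Fin 3)),
      (fun x => x - (2 * ⟪x, W κ₀⟫_ℝ) • W κ₀) '' ((fun x => x - (2 * ⟪x, W κ₀⟫_ℝ) • W κ₀) '' S) = S := by
    intro S
    rw [Set.image_image]
    conv_rhs => rw [← Set.image_id S]
    exact Set.image_congr fun x _ => reflect_reflect_unit hm x
  rw [image_twinFrame_eq A₂ hm, hA₂', image_twinFrame_eq W hm, hinv]

/-- **(M1) for a two-letter word.**  `A₂·Λ₀ = (wordFrame A₁ [κ₀, κ₁])·Λ₀` with unit model menu letters, and every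
steep-up slot `u₁` of grain 1 adjacent to the first plane (`⟪u₁, κ₁⟫ ≠ 0`) ⇒ `RayAlignedAt A₁ A₂`. -/
theorem rayAlignedAt_of_word_two_up {A₁ A₂ : EuclideanSpace ℝ (Fin 3) ≃ₗᵢ[ℝ] EuclideanSpace ℝ (Fin 3)}
    {κ₀ κ₁ : EuclideanSpace ℝ (Fin 3)}
    (hκ₀ : ‖κ₀‖ = 1 ∧ ∀ w ∈ fccSlots, ⟪w, κ₀⟫_ℝ = 0 ∨ ⟪w, κ₀⟫_ℝ = Real.sqrt (2 / 3) ∨ ⟪w, κ₀⟫_ℝ = -Real.sqrt (2 / 3))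
    (hκ₁ : ‖κ₁‖ = 1 ∧ ∀ w ∈ fccSlots, ⟪w, κ₁⟫_ℝ = 0 ∨ ⟪w, κ₁⟫_ℝ = Real.sqrt (2 / 3) ∨ ⟪w, κ₁⟫_ℝ = -Real.sqrt (2 / 3))
    (hA₂ : A₂ '' fccStacking 1 (Real.sqrt (2 / 3)) = (wordFrame A₁ [κ₀, κ₁]) '' fccStacking 1 (Real.sqrt (2 / 3)))
    (hadj : ∀ u₁ ∈ fccSlots, Real.sqrt 2 / 2 ≤ ⟪A₁ u₁, EuclideanSpace.single (2 : Fin 3) (1 : ℝ)⟫_ℝ → ⟪u₁, κ₁⟫_ℝ ≠ 0) :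
    RayAlignedAt A₁ A₂ := by
  obtain ⟨hm, hmenu₂, htwin⟩ := backPlane_twin hκ₀ hA₂
  have hm₁ : ‖A₁ κ₁‖ = 1 := by rw [LinearIsometryEquiv.norm_map, hκ₁.1]
  refine rayAlignedAt_of_adjacent_up hm₁ (menu_frame_of_model A₁ hκ₁.2) (fun u₁ hu₁ hs₁ => ?_)
    (Or.inr ⟨_, hm, hmenu₂, by rw [← wordFrame_singleton_eq_twinFrame A₁ hκ₁.1, htwin]⟩)
  rw [LinearIsometryEquiv.inner_map_map]; exact hadj u₁ hu₁ hs₁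

/-- **(M2) for a two-letter word.**  `A₂·Λ₀ = (wordFrame A₁ [κ₀, κ₁])·Λ₀` with unit model menu letters, and every
steep-down slot `u₂` of grain 2 adjacent to the BACK plane `m = (wordFrame A₁ [κ₁]) κ₀` (`⟪A₂ u₂, m⟫ ≠ 0`)
⇒ `RayAlignedAt A₁ A₂`. -/
theorem rayAlignedAt_of_word_two_down {A₁ A₂ : EuclideanSpace ℝ (Fin 3) ≃ₗᵢ[ℝ] EuclideanSpace ℝ (Fin 3)}
    {κ₀ κ₁ : EuclideanSpace ℝ (Fin 3)}
    (hκ₀ : ‖κ₀‖ = 1 ∧ ∀ w ∈ fccSlots, ⟪w, κ₀⟫_ℝ = 0 ∨ ⟪w, κ₀⟫_ℝ = Real.sqrt (2 / 3) ∨ ⟪w, κ₀⟫_ℝ = -Real.sqrt (2 / 3))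
    (hκ₁ : ‖κ₁‖ = 1 ∧ ∀ w ∈ fccSlots, ⟪w, κ₁⟫_ℝ = 0 ∨ ⟪w, κ₁⟫_ℝ = Real.sqrt (2 / 3) ∨ ⟪w, κ₁⟫_ℝ = -Real.sqrt (2 / 3))
    (hA₂ : A₂ '' fccStacking 1 (Real.sqrt (2 / 3)) = (wordFrame A₁ [κ₀, κ₁]) '' fccStacking 1 (Real.sqrt (2 / 3)))
    (hadj : ∀ u₂ ∈ fccSlots, ⟪A₂ u₂, EuclideanSpace.single (2 : Fin 3) (1 : ℝ)⟫_ℝ ≤ -(Real.sqrt 2 / 2) →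
      ⟪A₂ u₂, wordFrame A₁ [κ₁] κ₀⟫_ℝ ≠ 0) :
    RayAlignedAt A₁ A₂ := by
  obtain ⟨hm, hmenu₂, htwin⟩ := backPlane_twin hκ₀ hA₂
  have hm₁ : ‖A₁ κ₁‖ = 1 := by rw [LinearIsometryEquiv.norm_map, hκ₁.1]
  exact rayAlignedAt_of_adjacent_down hm hmenu₂ hadj
    (Or.inr ⟨A₁ κ₁, hm₁, menu_frame_of_model A₁ hκ₁.2, by rw [← htwin, wordFrame_singleton_eq_twinFrame A₁ hκ₁.1]⟩)

end Summit.Ventures.Crystal3D.Theorems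

end
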